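import Summits.CriticalPhenomena.PercolationContinuityZ3.Theorems.Transplant.SkelConcRootHop
import Summits.CriticalPhenomena.PercolationContinuityZ3.Theorems.Transplant.SkelPhiFatSeqOff
import Summits.CriticalPhenomena.PercolationContinuityZ3.Theorems.Transplant.SkelPhiCellsConcG
import HarnessLib

/-!
# D″ node, (R) layer, file 4 (R-RECUT-PLAN §1 row 5, DPRIME-SCOPE §3 (R) "first hop = first band step", p3 addendum M.9 (3)): the FIRST
# HOP of the root run at φ-LEVEL — under the root law cut to a world `U' ⊇` (a window over) the wired root cube, the root `w₀` is joined to
# the target `T c` of a link input at an OFF-CENTRE vertex `c` over a planar point `x₀ ∈ P.Q 0` (any link `linkIn ↑(Qp c) (fatSeqOff off c k)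
# (T c)` valid for `P_q`, e.g. p1-g9's Step-I′ side input `Skelφ.link_at_center`: `Qp c` = the band rectangle prism, `T c` = a side-half on
# the landing row) with probability `> 1 − δ`, given a WIRED WALK from `w₀` to `c` inside the root-cube window (`Steps`, box convexity) and
# the seed `fatSeqOff off c k` inside that window (all their inside edges are edges of the wired cube `U₀`, hence almost surely open) — the
# φ-level successor of p2-g4's `SkelConcRootHop` (`PlanarSkeletonConc.exists_wiredWalk`, `Skel.root_hsrc_of_walk`, `Skel.root_hsrcSG`,
# typed over `Φ : PlanarSkeletonConc G` with the square fat prisms `fatSeq` and quarter-faces `macroPiece`)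

builds on p205010 (kernel theorem, internal audit signed; external expert review pending) — nothing in this file uses p205010.
Status sentence (coordinator 2026-08-20T04:30Z): "θ(p_c) = 0 on ℤ^d, all d ≥ 2 — kernel-verified (Lean 4/Mathlib, standard axioms); internal
adversarial audit SIGNED 2026-08-20 04:29Z; external expert review pending."
Lane `prim-bschramm-*`, seat `prim-bschramm-p2` (gen 8; (R) = p2 lineage under D″); helper file (`--supports stmt-CriticalPhenomena-4575`).

DICTIONARY (addendum K): `Φ.step ↦ hstep` (the walk), `fatSeq Φ hC c k ↦ Skelφ.fatSeqOff hfr hC off c k` (p1-g9, the Step-I′ zone family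
`D.Λ`), `macroPiece … g ↦` ANY target finset `T c` of ANY link prism `Qp c` (the band rectangle and its side-half are supplied by the consumer,
file `SkelPhiRootClauses`, from `Skelφ.link_at_center`); the cut-root-law facts `Skel.W0sub_eq_one_of_mem_U₀ / le_W0sub_of_mem / W0sub_ae_open`
and the domination transfer `Skel.real_ge_bondPercolation_of_le` are Φ-free and IMPORTED (K2.5).
* §1 **`Skelφ.exists_wiredWalk (hstep)`** — a step-walk from `w₀` to a vertex over `x₀` inside the box window `Win w₀ (Icc lo hi) ‖x₀ − φ w₀‖₁`;
* §2 **`Skel.root_hsrc_of_wired`** (Φ-free, any link prism / seed / target) — the first hop from a wired, internally connected source under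
  the cut root law `W0sub U'`;
* §3 **`Skelφ.root_hsrcSG (hstep hfr hC)`** — for the two-unit scheme of record `⟨Skelφ.cellGeomSG G φ P w₀ Λ, q, δc⟩`: walk + seed inside
  `Win w₀ (P.Q 0) R₀` with `R₀ ≤ rQ 0 0`, link prism inside `U'`.
[cite: KozmaNitzan2024, §4 p. 27 (G₀: the wired cube), p. 28 ((32) at the root), Lemma 9 (p. 16), Lemma 11 (p. 23)]
-/

noncomputable section

open MeasureTheory
open scoped Classical

namespace Summit.CriticalPhenomena.PercolationContinuityZ3.Theorems

namespace Transplant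

/-! ## §1 The wired walk inside a box window, from `Steps` -/

namespace Skelφ

open Literature.Probability.Percolation Literature.Probability.LatticeModels SimpleGraph
open Literature.Barriers.CriticalPhenomena (graphBall mem_graphBall_self graphBall_mono)

variable {V : Type} [DecidableEq V] {G : SimpleGraph V} [G.LocallyFinite] {φ : V → Site 2}

/-- **A step-walk from `w₀` to a vertex over `x₀` inside the box window** (from `Steps`): if `φ w₀` and `x₀` lie in the box `Icc lo hi`,
there are a vertex `c` with `φ c = x₀` and a finite set `Wk ∋ w₀, c` of vertices inside `Win w₀ (Icc lo hi) ‖x₀ − φ w₀‖₁`, every one of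
which is joined to `w₀` by a `G`-path inside `Wk` (ℓ¹-induction; the box is monotone-path convex).  φ-level twin of
`PlanarSkeletonConc.exists_wiredWalk`. [cite: KozmaNitzan2024, §4 p. 27 (G₀), p. 26 ((29))] -/
theorem exists_wiredWalk (hstep : Steps G φ) (w₀ : V) {lo hi : Site 2} (h0 : φ w₀ ∈ Finset.Icc lo hi) (x₀ : Site 2)
    (hx : x₀ ∈ Finset.Icc lo hi) :
    ∃ (c : V) (Wk : Finset V), φ c = x₀ ∧ c ∈ Wk ∧ w₀ ∈ Wk ∧
      Wk ⊆ Win G φ w₀ (Finset.Icc lo hi) ((x₀ 0 - φ w₀ 0).natAbs + (x₀ 1 - φ w₀ 1).natAbs) ∧ ∀ s ∈ Wk, PathIn G (↑Wk : Set V) w₀ s := by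
  suffices h : ∀ (n : ℕ) (y : Site 2), y ∈ Finset.Icc lo hi → (y 0 - φ w₀ 0).natAbs + (y 1 - φ w₀ 1).natAbs = n →
      ∃ (c : V) (Wk : Finset V), φ c = y ∧ c ∈ Wk ∧ w₀ ∈ Wk ∧ Wk ⊆ Win G φ w₀ (Finset.Icc lo hi) n ∧
        ∀ s ∈ Wk, PathIn G (↑Wk : Set V) w₀ s from h _ x₀ hx rfl
  intro n
  induction n with
  | zero =>
    intro y hy hn
    have hy0 : (y 0 - φ w₀ 0).natAbs = 0 := by omega
    have hy1 : (y 1 - φ w₀ 1).natAbs = 0 := by omega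
    have hyw : φ w₀ = y := by
      funext i
      fin_cases i
      · exact (sub_eq_zero.1 (Int.natAbs_eq_zero.1 hy0)).symm
      · exact (sub_eq_zero.1 (Int.natAbs_eq_zero.1 hy1)).symm
    have hmem : w₀ ∈ Win G φ w₀ (Finset.Icc lo hi) 0 := (mem_Win G φ).2 ⟨mem_graphBall_self G w₀ 0, h0⟩
    refine ⟨w₀, {w₀}, hyw, Finset.mem_singleton_self _, Finset.mem_singleton_self _, Finset.singleton_subset_iff.2 hmem, ?_⟩
    intro s hs
    rw [Finset.mem_singleton] at hs
    subst hs
    exact PathIn.refl (by simp)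
  | succ n ih =>
    intro y hy hn
    have hex : ∃ i : Fin 2, y i ≠ φ w₀ i := by
      by_contra hcon
      push Not at hcon
      have := hcon 0; have := hcon 1
      simp_all
    obtain ⟨i, hne⟩ := hex
    set σ : ℤˣ := if φ w₀ i < y i then 1 else -1 with hσdef
    set y' : Site 2 := y - Pi.single i (σ : ℤ) with hy'def
    have hy'i : y' i = y i - (σ : ℤ) := by simp [hy'def]
    have hy'j : ∀ j, j ≠ i → y' j = y j := by intro j hj; simp [hy'def, hj]
    have hσ : (φ w₀ i < y i ∧ (σ : ℤ) = 1) ∨ (y i < φ w₀ i ∧ (σ : ℤ) = -1) := by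
      by_cases hlt : φ w₀ i < y i
      · exact Or.inl ⟨hlt, by rw [hσdef, if_pos hlt]; rfl⟩
      · exact Or.inr ⟨lt_of_le_of_ne (not_lt.1 hlt) hne, by rw [hσdef, if_neg hlt]; rfl⟩
    have hdist : (y' 0 - φ w₀ 0).natAbs + (y' 1 - φ w₀ 1).natAbs = n := by
      have key : (y' i - φ w₀ i).natAbs + 1 = (y i - φ w₀ i).natAbs := by
        rw [hy'i]; rcases hσ with ⟨h1, h2⟩ | ⟨h1, h2⟩ <;> rw [h2] <;> omega
      fin_cases i
      · have h1 := hy'j 1 (by decide)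
        simp only [Fin.zero_eta] at key
        rw [h1]; omega
      · have h0' := hy'j 0 (by decide)
        simp only [Fin.mk_one] at key
        rw [h0']; omega
    -- the intermediate point stays in the box (between `y i` and `φ w₀ i` in coordinate `i`)
    have hy'box : y' ∈ Finset.Icc lo hi := by
      rw [Literature.Probability.Percolation.KozmaNitzan.mem_Icc_iff] at hy h0 ⊢
      intro j
      by_cases hj : j = i
      · rw [hj, hy'i]
        obtain ⟨h5, h6⟩ := hy i
        obtain ⟨h7, h8⟩ := h0 i
        rcases hσ with ⟨h1, h2⟩ | ⟨h1, h2⟩ <;> rw [h2] <;> constructor <;> omega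
      · rw [hy'j j hj]; exact hy j
    obtain ⟨c', Wk', hφc', hc', hw₀, hWk', hpath⟩ := ih y' hy'box hdist
    obtain ⟨c, hadj, hφc⟩ := hstep c' i σ
    have hφcy : φ c = y := by rw [hφc, hφc', hy'def, sub_add_cancel]
    have hcWin : c ∈ Win G φ w₀ (Finset.Icc lo hi) (n + 1) := by
      have hc'ball : c' ∈ graphBall G w₀ n := ((mem_Win G φ).1 (hWk' hc')).1
      exact (mem_Win G φ).2 ⟨BoxProdZ2.mem_graphBall_succ_of_adj G hc'ball hadj, hφcy ▸ hy⟩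
    refine ⟨c, insert c Wk', hφcy, Finset.mem_insert_self _ _, Finset.mem_insert_of_mem hw₀, ?_, ?_⟩
    · exact Finset.insert_subset hcWin (hWk'.trans (Win_mono G φ subset_rfl (Nat.le_succ n)))
    · intro s hs
      have hsub : (↑Wk' : Set V) ⊆ ↑(insert c Wk') := Finset.coe_subset.2 (Finset.subset_insert _ _)
      rcases Finset.mem_insert.1 hs with rfl | hs
      · exact ((hpath c' hc').mono hsub).tail hadj (by simp)
      · exact (hpath s hs).mono hsub

end Skelφ

/-! ## §2 The first hop from a wired, internally connected source — any link prism, seed, target -/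

namespace Skel

open Literature.Probability.Percolation Literature.Probability.LatticeModels SimpleGraph KNCells KNLevels
open Literature.Probability.Percolation.KozmaNitzan (wireSet_mono)

variable {V : Type} [DecidableEq V] [Countable V] {G : SimpleGraph V} [G.LocallyFinite]
variable {A : Type*} {S : KSchA V A}

omit [DecidableEq V] [Countable V] [G.LocallyFinite] in
/-- Monotonicity of `μ.real` along an almost-sure implication (finite measures). [folklore] -/
private theorem measureReal_mono_ae'' {α : Type*} [MeasurableSpace α] {μ : Measure α} [IsFiniteMeasure μ] {s t : Set α}
    (h : ∀ᵐ x ∂μ, x ∈ s → x ∈ t) : μ.real s ≤ μ.real t := by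
  rw [measureReal_def, measureReal_def]
  exact ENNReal.toReal_mono (measure_ne_top _ _) (measure_mono_ae h)

/-- **The first hop from a wired, internally connected source under the cut root law** (Φ-free, generic in the link): under `W0sub U'`,
with a link input `linkIn ↑Qp Sd T` valid for `P_q` (`q = S.p`), the link prism `Qp ⊆ U'`, and a finite `Sw ⊆ U'` with `Sd ⊆ Sw`, every
vertex of `Sw` joined to the root `o` inside `Sw`, and every `G`-edge inside `Sw` an edge of the wired cube `U₀`:
`1 − δ < P_{W0sub U'}(⋃_{t ∈ T} o ↔ t)` (the link is increasing and determined inside `Qp`, where the cut root law is `≥ q`; the source's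
edges are a.s. open).  Generalises `Skel.root_hsrc_of_walk` (square fat prisms, quarter-faces).
[cite: KozmaNitzan2024, §4 p. 28 ((32) at the root), Lemma 9 (p. 16), Lemma 11 (p. 23)] -/
theorem root_hsrc_of_wired {U' Sw Qp Sd T : Finset V} {o : V} {δ : ℝ}
    (hlink : 1 - δ < (bondPercolation G S.p).real (linkIn (↑Qp : Set V) Sd T))
    (hQU : Qp ⊆ U') (hSwU : Sw ⊆ U') (hSd : Sd ⊆ Sw)
    (hconn : ∀ s ∈ Sw, PathIn G (↑Sw : Set V) o s) (hwired : ∀ u ∈ Sw, ∀ u' ∈ Sw, G.Adj u u' → s(u, u') ∈ S.U₀ G) :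
    1 - δ < (prodBernoulli (S.W0sub G U')).real (⋃ t ∈ T, openConn o t) := by
  set μ := prodBernoulli (S.W0sub G U') with hμ
  -- the link under the cut root law (weights `≥ q` inside `Qp ⊆ U'`), seed enlarged to the wired source `Sw`
  have h1 : 1 - δ < μ.real (linkIn (↑Qp : Set V) Sw T) :=
    (hlink.trans_le (real_ge_bondPercolation_of_le (fun u hu u' hu' hadj => le_W0sub_of_mem (S := S) (hQU hu) (hQU hu') hadj)
      (isUpperSet_linkIn _ _ _) (determinedBy_linkIn (↑Qp : Set V) Sd T le_rfl) (measurableSet_linkIn _ _ _))).trans_le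
      (measureReal_mono (linkIn_mono le_rfl hSd subset_rfl) (measure_ne_top _ _))
  -- enlarge the ambient set of the link to `U'`
  have h2 : 1 - δ < μ.real (linkIn (↑U' : Set V) Sw T) :=
    h1.trans_le (measureReal_mono (linkIn_mono (Finset.coe_subset.2 hQU) subset_rfl subset_rfl) (measure_ne_top _ _))
  refine lt_of_lt_of_le h2 (measureReal_mono_ae'' ?_)
  filter_upwards [W0sub_ae_open (S := S) (G := G) U'] with ω hopen hω
  have h3 := linkIn_subset_biUnion_openConnIn_of_wired (G := G) (Finset.coe_subset.2 hSwU) (o := o) hconn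
    (fun a b ha hb hab => hopen a b (hSwU (Finset.mem_coe.1 ha)) (hSwU (Finset.mem_coe.1 hb))
      (hwired a (Finset.mem_coe.1 ha) b (Finset.mem_coe.1 hb) hab)) hω
  simp only [Set.mem_iUnion, exists_prop] at h3 ⊢
  obtain ⟨t, ht, h4⟩ := h3
  exact ⟨t, ht, openConnIn_subset_openConn _ _ _ h4⟩

end Skel

/-! ## §3 The first hop of the root run for the two-unit scheme of record -/

namespace Skelφ

open Literature.Probability.Percolation Literature.Probability.LatticeModels SimpleGraph KNCells KNLevels
open Literature.Barriers.CriticalPhenomena (graphBall mem_graphBall_self graphBall_mono)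
open BoxProdZ2 (ConcRadiiG)
open Skel (root_hsrc_of_wired)

variable {V : Type} [DecidableEq V] [Countable V] {G : SimpleGraph V} [G.LocallyFinite] {φ : V → Site 2} {types : Finset V}

/-- **THE FIRST HOP OF THE ROOT RUN for the two-unit scheme of record** `⟨Skelφ.cellGeomSG G φ P w₀ Λ, q, δc⟩`: the wired source is a
step-walk from `w₀` to a vertex `c` over `x₀ ∈ P.Q 0` together with the seed `fatSeqOff off c k`, both inside the root-cube window
`Win w₀ (P.Q 0) R₀` with `R₀ ≤ rQ 0 0` (so all their inside edges are edges of the wired cube), and the link prism `Qp c` lies in the cut root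
world `U'`; the link input at `c` (seed `fatSeqOff off c k`, target `T c`, inside `Qp c`) is valid for `P_q`.  Then for SOME vertex `c` over `x₀` within
`‖x₀‖₁` of `w₀`: `1 − δ < P_{W0sub U'}(⋃_{t ∈ T c} w₀ ↔ t)`. [cite: KozmaNitzan2024, §4 p. 28 ((32) at the root), Lemma 9 (p. 16), Lemma 11 (p. 23)] -/
theorem root_hsrcSG (hstep : Steps G φ) (hfr : Frames G φ types) {p : unitInterval} (hC : CylSubcritical G φ types p) (P : PCells2)
    (w₀ : V) {Λ : ConcRadiiG} (hφ : φ w₀ = 0) (q : unitInterval) (δc : ℝ) {U' : Finset V} {x₀ : Site 2} (hx₀ : x₀ ∈ P.Q 0)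
    {R₀ : ℕ} (hR₀Q : R₀ ≤ Λ.rQ 0 0) (hWU : Win G φ w₀ (P.Q 0) R₀ ⊆ U') (hn : (x₀ 0).natAbs + (x₀ 1).natAbs ≤ R₀)
    {off k : ℕ} {δ : ℝ} (Qp T : V → Finset V)
    (hlink : ∀ c, φ c = x₀ → c ∈ graphBall G w₀ ((x₀ 0).natAbs + (x₀ 1).natAbs) →
      fatSeqOff hfr hC off c k ⊆ Win G φ w₀ (P.Q 0) R₀ ∧ Qp c ⊆ U' ∧
      1 - δ < (bondPercolation G q).real (linkIn (↑(Qp c) : Set V) (fatSeqOff hfr hC off c k) (T c))) :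
    ∃ c, φ c = x₀ ∧ c ∈ graphBall G w₀ ((x₀ 0).natAbs + (x₀ 1).natAbs) ∧
      1 - δ < (prodBernoulli ((⟨cellGeomSG G φ P w₀ Λ, q, δc⟩ : KSchA V ℕ).W0sub G U')).real (⋃ t ∈ T c, openConn w₀ t) := by
  set S' : KSchA V ℕ := ⟨cellGeomSG G φ P w₀ Λ, q, δc⟩ with hS'
  -- the walk inside the root-cube box
  have h0 : φ w₀ ∈ P.Q 0 := by rw [hφ]; exact P.zero_mem_Q_zero
  obtain ⟨c, Wk, hφc, hc, hw₀, hWk, hpath⟩ := exists_wiredWalk hstep w₀ (lo := P.cen 0 - P.hw 5) (hi := P.cen 0 + P.hw 5) h0 x₀ hx₀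
  simp only [hφ, Pi.zero_apply, sub_zero] at hWk
  have hcball : c ∈ graphBall G w₀ ((x₀ 0).natAbs + (x₀ 1).natAbs) := ((mem_Win G φ).1 (hWk hc)).1
  obtain ⟨hkQ, hQU, hlk⟩ := hlink c hφc hcball
  have hWkQ : Wk ⊆ Win G φ w₀ (P.Q 0) R₀ := hWk.trans (Win_mono G φ subset_rfl hn)
  refine ⟨c, hφc, hcball, root_hsrc_of_wired (S := S') (Sw := Wk ∪ fatSeqOff hfr hC off c k) hlk hQU ?_
    Finset.subset_union_right ?_ ?_⟩
  · -- the wired source `Wk ∪ fatSeqOff c k` lies in `U'`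
    exact Finset.union_subset (hWkQ.trans hWU) (hkQ.trans hWU)
  · -- every vertex of the source is joined to `w₀` inside it: along the walk to `c`, then inside the seed
    intro s hs
    have hsubW : (↑Wk : Set V) ⊆ ↑(Wk ∪ fatSeqOff hfr hC off c k) := Finset.coe_subset.2 Finset.subset_union_left
    have hsubK : (↑(fatSeqOff hfr hC off c k) : Set V) ⊆ ↑(Wk ∪ fatSeqOff hfr hC off c k) :=
      Finset.coe_subset.2 Finset.subset_union_right
    rcases Finset.mem_union.1 hs with hs | hs
    · exact (hpath s hs).mono hsubW
    · have hcs : PathIn G (↑(fatSeqOff hfr hC off c k) : Set V) c s := by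
        have hcoe : (↑(fatSeqOff hfr hC off c k) : Set V) = cylBall G φ c k (fatRadius hfr hC k + off) := by
          ext v; rw [Finset.mem_coe, mem_fatSeqOff_iff]
        rw [hcoe]
        exact pathIn_cylBall G φ ((mem_fatSeqOff_iff hfr hC off).1 hs)
      exact ((hpath c hc).mono hsubW).trans (hcs.mono hsubK)
  · -- every edge inside the source is an edge of the wired cube `edgesIn (Q_0)` (window ⊆ span-window, `R₀ ≤ rQ 0 0`)
    intro u hu u' hu' hadj
    have hW : ∀ v ∈ Wk ∪ fatSeqOff hfr hC off c k, v ∈ Win G φ w₀ (P.Q 0) (Λ.rQ 0 0) := fun v hv => by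
      rcases Finset.mem_union.1 hv with hv | hv
      · exact Win_mono G φ subset_rfl hR₀Q (hWkQ hv)
      · exact Win_mono G φ subset_rfl hR₀Q (hkQ hv)
    change s(u, u') ∈ edgesIn G (VWin G φ w₀ (P.Q 0) (Λ.rQ 0 0))
    rw [edgesIn_VWin, mem_edgesIn_iff]
    refine ⟨(SimpleGraph.mem_edgeSet G).2 hadj, fun v hv => ?_⟩
    rcases Sym2.mem_iff.1 hv with rfl | rfl
    · exact hW _ hu
    · exact hW _ hu'

end Skelφ

end Transplant

end Summit.CriticalPhenomena.PercolationContinuityZ3.Theorems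

end
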